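import Mathlib
import HarnessLib
import HarnessLib.Audit

/-!
# Legendre's relation by moves, I: the exactness certificate (solo-informed, s33)

First file of THEOREM XVII ("Legendre's relation `E K' + E' K − K K' = π/2` is a theorem of the
Kontsevich–Zagier calculus").  Write `m' = 1 − m` and, for `s, t ∈ (0,1)`,

  `k(s,t,m) = (1−s²)^{-1/2} (1−m s²)^{-1/2} (1−t²)^{-1/2} (1−m' t²)^{-1/2}`,
  `F(s,t,m) = (1 − m s² − m' t²) · k = η_m(s)κ_{m'}(t) + κ_m(s)η_{m'}(t) − κ_m(s)κ_{m'}(t)`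

(`κ_m(s) = ((1−s²)(1−ms²))^{-1/2}` the first-kind and `η_m = (1 − m s²)κ_m` the second-kind
Legendre integrand), so that `∬_{(0,1)²} F(·,·,m) = E(m)K(m') + E(m')K(m) − K(m)K(m')`.  This file is
pure calculus — the CERTIFICATE that the modulus-derivative of `F` is an explicit divergence with
primitives vanishing on the boundary of the square:

  `∂_m F = ∂_s A + ∂_t B`,  `A = ½ t² s(1−s²) k`,  `B = −½ s² t(1−t²) k`

(`soloInformed_legendre_hasDerivAt_m/_s/_t`, `soloInformed_legendre_certificate`), the degenerate
fibre `F(s,t,0) = (1−s²)^{-1/2}` and the domination of all three integrands on `(0,1)² × (0,μ]`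
(`soloInformed_legendre_kernel_le`), which makes the Newton–Leibniz moves of the next files
absolutely convergent down to `m = 0` (classically one passes to the LIMIT `k → 0` instead:
Whittaker–Watson §22.8, McKean–Moll §2.4).  References: A. M. Legendre, *Traité des fonctions
elliptiques* I (1825), Ch. 12; E. T. Whittaker, G. N. Watson, *A Course of Modern Analysis*, §22.8;
H. McKean, V. Moll, *Elliptic Curves* (1999), §2.4; M. Kontsevich, D. Zagier, *Periods* (2001),
§1.2; this work (solo-informed s33).
-/

noncomputable section

open Set

namespace Summit.KontsevichZagierPeriods.KontsevichZagierPeriods.Theorems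

/-- `d/dx (√(f x))⁻¹ = c · (√(f x))⁻¹` whenever `f x > 0` and `c · 2 f(x) = −f′`. [folklore] -/
theorem soloInformed_hasDerivAt_inv_sqrt {f : ℝ → ℝ} {f' x : ℝ} (hf : HasDerivAt f f' x)
    (hx : 0 < f x) (c : ℝ) (hc : c * (2 * f x) = -f') :
    HasDerivAt (fun y => (√(f y))⁻¹) (c * (√(f x))⁻¹) x := by
  have hne : √(f x) ≠ 0 := (Real.sqrt_pos.2 hx).ne'
  have hfx : f x ≠ 0 := hx.ne'
  refine ((hf.sqrt hx.ne').inv hne).congr_deriv ?_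
  rw [Real.sq_sqrt hx.le, show c = -f' / (2 * f x) by rw [← hc]; field_simp]
  field_simp

/-- `d/dx x² = 2x`. [folklore] -/
theorem soloInformed_hasDerivAt_sq (x : ℝ) : HasDerivAt (fun y : ℝ => y ^ 2) (2 * x) x := by
  simpa using hasDerivAt_pow 2 x

/-- On `s ∈ (0,1)`, `m < 1`: `0 < 1 − s²` and `0 < 1 − m s²`. [folklore] -/
theorem soloInformed_legendre_radicand_pos {s m : ℝ} (hs : s ∈ Ioo (0:ℝ) 1)
    (hm1 : m < 1) : 0 < 1 - s ^ 2 ∧ 0 < 1 - m * s ^ 2 := by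
  have hs2 : s ^ 2 < 1 := by nlinarith [hs.1, hs.2]
  refine ⟨by linarith, ?_⟩
  nlinarith [sq_nonneg s]

/-- On `t ∈ (0,1)`, `0 ≤ m`: `0 < 1 − (1 − m) t²` (indeed `≥ 1 − t²`). [folklore] -/
theorem soloInformed_legendre_radicand_pos' {t m : ℝ} (ht : t ∈ Ioo (0:ℝ) 1) (hm0 : 0 ≤ m) :
    0 < 1 - (1 - m) * t ^ 2 := by
  have ht2 : t ^ 2 < 1 := by nlinarith [ht.1, ht.2]
  nlinarith [sq_nonneg t]

/-! ### Partial derivatives of the kernel -/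

/-- **`∂_m k = [s²/(2(1−ms²)) − t²/(2(1−m't²))] · k`** for `s, t ∈ (0,1)`, `0 ≤ m < 1`.
[this work] -/
theorem soloInformed_legendre_kernel_hasDerivAt_m {s t m : ℝ} (hs : s ∈ Ioo (0:ℝ) 1)
    (ht : t ∈ Ioo (0:ℝ) 1) (hm0 : 0 ≤ m) (hm1 : m < 1) :
    HasDerivAt (fun m : ℝ =>
        (√(1 - s ^ 2))⁻¹ * (√(1 - m * s ^ 2))⁻¹ * ((√(1 - t ^ 2))⁻¹ * (√(1 - (1 - m) * t ^ 2))⁻¹))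
      ((s ^ 2 / (2 * (1 - m * s ^ 2)) - t ^ 2 / (2 * (1 - (1 - m) * t ^ 2))) *
        ((√(1 - s ^ 2))⁻¹ * (√(1 - m * s ^ 2))⁻¹ * ((√(1 - t ^ 2))⁻¹ * (√(1 - (1 - m) * t ^ 2))⁻¹)))
      m := by
  obtain ⟨-, hms⟩ := soloInformed_legendre_radicand_pos hs hm1
  have hmt := soloInformed_legendre_radicand_pos' ht hm0
  have hB : HasDerivAt (fun m : ℝ => (√(1 - m * s ^ 2))⁻¹)
      ((s ^ 2 / (2 * (1 - m * s ^ 2))) * (√(1 - m * s ^ 2))⁻¹) m :=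
    soloInformed_hasDerivAt_inv_sqrt (((hasDerivAt_id' m).mul_const (s ^ 2)).const_sub 1) hms _
      (by rw [div_mul_cancel₀ _ (mul_ne_zero two_ne_zero hms.ne')]; ring)
  have hD : HasDerivAt (fun m : ℝ => (√(1 - (1 - m) * t ^ 2))⁻¹)
      (-(t ^ 2 / (2 * (1 - (1 - m) * t ^ 2))) * (√(1 - (1 - m) * t ^ 2))⁻¹) m :=
    soloInformed_hasDerivAt_inv_sqrt
      ((((hasDerivAt_id' m).const_sub 1).mul_const (t ^ 2)).const_sub 1) hmt _
      (by rw [neg_mul, div_mul_cancel₀ _ (mul_ne_zero two_ne_zero hmt.ne')]; ring)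
  refine ((hB.const_mul ((√(1 - s ^ 2))⁻¹)).mul (hD.const_mul ((√(1 - t ^ 2))⁻¹))).congr_deriv ?_
  ring

/-- **`∂_s k = [s/(1−s²) + ms/(1−ms²)] · k`** for `s ∈ (0,1)`, `m < 1`. [this work] -/
theorem soloInformed_legendre_kernel_hasDerivAt_s {s m : ℝ} (t : ℝ) (hs : s ∈ Ioo (0:ℝ) 1)
    (hm1 : m < 1) :
    HasDerivAt (fun s : ℝ =>
        (√(1 - s ^ 2))⁻¹ * (√(1 - m * s ^ 2))⁻¹ * ((√(1 - t ^ 2))⁻¹ * (√(1 - (1 - m) * t ^ 2))⁻¹))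
      ((s / (1 - s ^ 2) + m * s / (1 - m * s ^ 2)) *
        ((√(1 - s ^ 2))⁻¹ * (√(1 - m * s ^ 2))⁻¹ * ((√(1 - t ^ 2))⁻¹ * (√(1 - (1 - m) * t ^ 2))⁻¹)))
      s := by
  obtain ⟨h1s, hms⟩ := soloInformed_legendre_radicand_pos hs hm1
  have hA : HasDerivAt (fun s : ℝ => (√(1 - s ^ 2))⁻¹) ((s / (1 - s ^ 2)) * (√(1 - s ^ 2))⁻¹) s :=
    soloInformed_hasDerivAt_inv_sqrt ((soloInformed_hasDerivAt_sq s).const_sub 1) h1s _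
      (by rw [mul_left_comm, div_mul_cancel₀ _ h1s.ne']; ring)
  have hB : HasDerivAt (fun s : ℝ => (√(1 - m * s ^ 2))⁻¹)
      ((m * s / (1 - m * s ^ 2)) * (√(1 - m * s ^ 2))⁻¹) s :=
    soloInformed_hasDerivAt_inv_sqrt (((soloInformed_hasDerivAt_sq s).const_mul m).const_sub 1)
      hms _ (by rw [mul_left_comm, div_mul_cancel₀ _ hms.ne']; ring)
  refine ((hA.mul hB).mul_const ((√(1 - t ^ 2))⁻¹ * (√(1 - (1 - m) * t ^ 2))⁻¹)).congr_deriv ?_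
  ring

/-- **`∂_t k = [t/(1−t²) + m't/(1−m't²)] · k`** for `t ∈ (0,1)`, `0 ≤ m < 1`, `m' = 1 − m`.
[this work] -/
theorem soloInformed_legendre_kernel_hasDerivAt_t {t m : ℝ} (s : ℝ) (ht : t ∈ Ioo (0:ℝ) 1)
    (hm0 : 0 ≤ m) (hm1 : m < 1) :
    HasDerivAt (fun t : ℝ =>
        (√(1 - s ^ 2))⁻¹ * (√(1 - m * s ^ 2))⁻¹ * ((√(1 - t ^ 2))⁻¹ * (√(1 - (1 - m) * t ^ 2))⁻¹))
      ((t / (1 - t ^ 2) + (1 - m) * t / (1 - (1 - m) * t ^ 2)) *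
        ((√(1 - s ^ 2))⁻¹ * (√(1 - m * s ^ 2))⁻¹ * ((√(1 - t ^ 2))⁻¹ * (√(1 - (1 - m) * t ^ 2))⁻¹)))
      t := by
  have h1t : 0 < 1 - t ^ 2 := (soloInformed_legendre_radicand_pos ht hm1).1
  have hmt := soloInformed_legendre_radicand_pos' ht hm0
  have hC : HasDerivAt (fun t : ℝ => (√(1 - t ^ 2))⁻¹) ((t / (1 - t ^ 2)) * (√(1 - t ^ 2))⁻¹) t :=
    soloInformed_hasDerivAt_inv_sqrt ((soloInformed_hasDerivAt_sq t).const_sub 1) h1t _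
      (by rw [mul_left_comm, div_mul_cancel₀ _ h1t.ne']; ring)
  have hD : HasDerivAt (fun t : ℝ => (√(1 - (1 - m) * t ^ 2))⁻¹)
      (((1 - m) * t / (1 - (1 - m) * t ^ 2)) * (√(1 - (1 - m) * t ^ 2))⁻¹) t :=
    soloInformed_hasDerivAt_inv_sqrt
      (((soloInformed_hasDerivAt_sq t).const_mul (1 - m)).const_sub 1) hmt _
      (by rw [mul_left_comm, div_mul_cancel₀ _ hmt.ne']; ring)
  refine ((hC.mul hD).const_mul ((√(1 - s ^ 2))⁻¹ * (√(1 - m * s ^ 2))⁻¹)).congr_deriv ?_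
  ring

/-! ### The modulus derivative of the Legendre integrand -/

/-- **`∂_m F`.**  For `s, t ∈ (0,1)` and `0 ≤ m < 1`,
`∂_m [(1 − m s² − m't²) k] = [(t² − s²) + (1 − m s² − m't²)(s²/(2(1−ms²)) − t²/(2(1−m't²)))] · k`,
`m' = 1 − m`. [this work] -/
theorem soloInformed_legendre_hasDerivAt_m {s t m : ℝ} (hs : s ∈ Ioo (0:ℝ) 1)
    (ht : t ∈ Ioo (0:ℝ) 1) (hm0 : 0 ≤ m) (hm1 : m < 1) :
    HasDerivAt (fun m : ℝ => (1 - m * s ^ 2 - (1 - m) * t ^ 2) *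
        ((√(1 - s ^ 2))⁻¹ * (√(1 - m * s ^ 2))⁻¹ * ((√(1 - t ^ 2))⁻¹ * (√(1 - (1 - m) * t ^ 2))⁻¹)))
      (((t ^ 2 - s ^ 2) + (1 - m * s ^ 2 - (1 - m) * t ^ 2) *
          (s ^ 2 / (2 * (1 - m * s ^ 2)) - t ^ 2 / (2 * (1 - (1 - m) * t ^ 2)))) *
        ((√(1 - s ^ 2))⁻¹ * (√(1 - m * s ^ 2))⁻¹ * ((√(1 - t ^ 2))⁻¹ * (√(1 - (1 - m) * t ^ 2))⁻¹)))
      m := by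
  have hN : HasDerivAt (fun m : ℝ => 1 - m * s ^ 2 - (1 - m) * t ^ 2) (t ^ 2 - s ^ 2) m := by
    refine ((((hasDerivAt_id' m).mul_const (s ^ 2)).const_sub 1).sub
      (((hasDerivAt_id' m).const_sub 1).mul_const (t ^ 2))).congr_deriv ?_
    ring
  refine (hN.mul (soloInformed_legendre_kernel_hasDerivAt_m hs ht hm0 hm1)).congr_deriv ?_
  ring

/-! ### The boundary primitives and their fibre derivatives -/

/-- **`∂_s A`.**  For `s, t ∈ (0,1)`, `0 ≤ m < 1`, with `A(s) = ½ t² · s(1−s²) · k(s,t,m)`: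
`∂_s A = ½ t² [1 − 2s² + m s²(1−s²)/(1−ms²)] · k`. [this work] -/
theorem soloInformed_legendre_hasDerivAt_s {s t m : ℝ} (hs : s ∈ Ioo (0:ℝ) 1)
    (hm1 : m < 1) :
    HasDerivAt (fun s : ℝ => t ^ 2 / 2 * (s * (1 - s ^ 2)) *
        ((√(1 - s ^ 2))⁻¹ * (√(1 - m * s ^ 2))⁻¹ * ((√(1 - t ^ 2))⁻¹ * (√(1 - (1 - m) * t ^ 2))⁻¹)))
      (t ^ 2 / 2 * (1 - 2 * s ^ 2 + m * s ^ 2 * (1 - s ^ 2) / (1 - m * s ^ 2)) *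
        ((√(1 - s ^ 2))⁻¹ * (√(1 - m * s ^ 2))⁻¹ * ((√(1 - t ^ 2))⁻¹ * (√(1 - (1 - m) * t ^ 2))⁻¹)))
      s := by
  obtain ⟨h1s, hms⟩ := soloInformed_legendre_radicand_pos hs hm1
  have h1s' : 1 - s ^ 2 ≠ 0 := h1s.ne'
  have hms' : 1 - m * s ^ 2 ≠ 0 := hms.ne'
  have hP : HasDerivAt (fun s : ℝ => s * (1 - s ^ 2)) (1 * (1 - s ^ 2) + s * (-(2 * s))) s :=
    (hasDerivAt_id' s).mul ((soloInformed_hasDerivAt_sq s).const_sub 1)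
  refine (((hP.const_mul (t ^ 2 / 2))).mul
    (soloInformed_legendre_kernel_hasDerivAt_s t hs hm1)).congr_deriv ?_
  generalize (√(1 - s ^ 2))⁻¹ * (√(1 - m * s ^ 2))⁻¹ *
    ((√(1 - t ^ 2))⁻¹ * (√(1 - (1 - m) * t ^ 2))⁻¹) = K
  generalize hD : 1 - s ^ 2 = D at *
  generalize hE : 1 - m * s ^ 2 = E at *
  field_simp
  subst hD hE
  ring

/-- **`∂_t B`.**  For `s, t ∈ (0,1)`, `0 ≤ m < 1`, with `B(t) = −½ s² · t(1−t²) · k(s,t,m)`: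
`∂_t B = −½ s² [1 − 2t² + m' t²(1−t²)/(1−m't²)] · k`, `m' = 1 − m`. [this work] -/
theorem soloInformed_legendre_hasDerivAt_t {s t m : ℝ} (ht : t ∈ Ioo (0:ℝ) 1)
    (hm0 : 0 ≤ m) (hm1 : m < 1) :
    HasDerivAt (fun t : ℝ => -(s ^ 2 / 2) * (t * (1 - t ^ 2)) *
        ((√(1 - s ^ 2))⁻¹ * (√(1 - m * s ^ 2))⁻¹ * ((√(1 - t ^ 2))⁻¹ * (√(1 - (1 - m) * t ^ 2))⁻¹)))
      (-(s ^ 2 / 2) * (1 - 2 * t ^ 2 + (1 - m) * t ^ 2 * (1 - t ^ 2) / (1 - (1 - m) * t ^ 2)) *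
        ((√(1 - s ^ 2))⁻¹ * (√(1 - m * s ^ 2))⁻¹ * ((√(1 - t ^ 2))⁻¹ * (√(1 - (1 - m) * t ^ 2))⁻¹)))
      t := by
  have h1t : 0 < 1 - t ^ 2 := (soloInformed_legendre_radicand_pos ht hm1).1
  have hmt := soloInformed_legendre_radicand_pos' ht hm0
  have h1t' : 1 - t ^ 2 ≠ 0 := h1t.ne'
  have hmt' : 1 - (1 - m) * t ^ 2 ≠ 0 := hmt.ne'
  have hP : HasDerivAt (fun t : ℝ => t * (1 - t ^ 2)) (1 * (1 - t ^ 2) + t * (-(2 * t))) t :=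
    (hasDerivAt_id' t).mul ((soloInformed_hasDerivAt_sq t).const_sub 1)
  refine (((hP.const_mul (-(s ^ 2 / 2)))).mul
    (soloInformed_legendre_kernel_hasDerivAt_t s ht hm0 hm1)).congr_deriv ?_
  generalize (√(1 - s ^ 2))⁻¹ * (√(1 - m * s ^ 2))⁻¹ *
    ((√(1 - t ^ 2))⁻¹ * (√(1 - (1 - m) * t ^ 2))⁻¹) = K
  generalize hD : 1 - t ^ 2 = D at *
  generalize hE : 1 - (1 - m) * t ^ 2 = E at *
  field_simp
  subst hD hE
  ring

/-! ### The certificate `∂_m F = ∂_s A + ∂_t B` -/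

/-- **The exactness certificate** (rational identity behind Legendre's relation): for
`s, t ∈ (0,1)`, `0 ≤ m < 1`, the modulus derivative of `F` is the sum of the two fibre derivatives
`∂_s A + ∂_t B`.  After dividing by the common kernel `k` it is the identity of rational functions
`(t² − s²) + N(s²/(2(1−ms²)) − t²/(2(1−m't²))) = ½t²[1 − 2s² + ms²(1−s²)/(1−ms²)]
− ½s²[1 − 2t² + m't²(1−t²)/(1−m't²)]`, `N = 1 − ms² − m't²`. [this work] -/
theorem soloInformed_legendre_certificate {s t m : ℝ} (hs : s ∈ Ioo (0:ℝ) 1)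
    (ht : t ∈ Ioo (0:ℝ) 1) (hm0 : 0 ≤ m) (hm1 : m < 1) (k : ℝ) :
    ((t ^ 2 - s ^ 2) + (1 - m * s ^ 2 - (1 - m) * t ^ 2) *
        (s ^ 2 / (2 * (1 - m * s ^ 2)) - t ^ 2 / (2 * (1 - (1 - m) * t ^ 2)))) * k =
      t ^ 2 / 2 * (1 - 2 * s ^ 2 + m * s ^ 2 * (1 - s ^ 2) / (1 - m * s ^ 2)) * k +
        -(s ^ 2 / 2) * (1 - 2 * t ^ 2 + (1 - m) * t ^ 2 * (1 - t ^ 2) / (1 - (1 - m) * t ^ 2)) * k := by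
  obtain ⟨-, hms⟩ := soloInformed_legendre_radicand_pos hs hm1
  have hmt := soloInformed_legendre_radicand_pos' ht hm0
  have hms' : 1 - m * s ^ 2 ≠ 0 := hms.ne'
  have hmt' : 1 - (1 - m) * t ^ 2 ≠ 0 := hmt.ne'
  rw [← add_mul]
  congr 1
  generalize hD : 1 - m * s ^ 2 = D at *
  generalize hE : 1 - (1 - m) * t ^ 2 = E at *
  field_simp
  subst hD hE
  ring

/-! ### The degenerate fibre `m = 0` and the boundary values of the primitives -/

/-- **Degenerate fibre**: at `m = 0` the Legendre integrand is `(1 − s²)^{-1/2}` (for `t² < 1`):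
`(1 − t²)·(√(1−s²))⁻¹ (√1)⁻¹ (√(1−t²))⁻¹ (√(1−t²))⁻¹ = (√(1−s²))⁻¹`. [this work] -/
theorem soloInformed_legendre_fibre_zero (s : ℝ) {t : ℝ} (ht : t ∈ Ioo (0:ℝ) 1) :
    (1 - 0 * s ^ 2 - (1 - 0) * t ^ 2) *
        ((√(1 - s ^ 2))⁻¹ * (√(1 - 0 * s ^ 2))⁻¹ * ((√(1 - t ^ 2))⁻¹ * (√(1 - (1 - 0) * t ^ 2))⁻¹)) =
      (√(1 - s ^ 2))⁻¹ := by
  have h1t : 0 < 1 - t ^ 2 := by nlinarith [ht.1, ht.2]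
  have hsq : (√(1 - t ^ 2))⁻¹ * (√(1 - t ^ 2))⁻¹ = (1 - t ^ 2)⁻¹ := by
    rw [← mul_inv, Real.mul_self_sqrt h1t.le]
  simp only [zero_mul, sub_zero, one_mul, Real.sqrt_one, inv_one, mul_one]
  rw [hsq]
  field_simp

/-- The kernel-free form of the primitive `A`: `s(1−s²)(√(1−s²))⁻¹ = s √(1−s²)` for every real `s`
(both sides vanish when `1 − s² ≤ 0`). [folklore] -/
theorem soloInformed_mul_one_sub_sq_mul_inv_sqrt (s : ℝ) :
    s * (1 - s ^ 2) * (√(1 - s ^ 2))⁻¹ = s * √(1 - s ^ 2) := by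
  rcases le_or_gt (1 - s ^ 2) 0 with h | h
  · rw [Real.sqrt_eq_zero'.2 h, inv_zero, mul_zero, mul_zero]
  · have hne : √(1 - s ^ 2) ≠ 0 := (Real.sqrt_pos.2 h).ne'
    rw [mul_assoc]
    congr 1
    rw [mul_inv_eq_iff_eq_mul₀ hne, Real.mul_self_sqrt h.le]

/-! ### Domination on `(0,1)² × [0, μ]` -/

/-- **The rational factors are bounded.**  For `s, t ∈ (0,1)` and `0 ≤ m ≤ μ < 1`: the three
kernel-free factors of `∂_m F`, `∂_s A`, `∂_t B` are bounded by `2 + (1 − μ)⁻¹` in absolute value.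
[this work] -/
theorem soloInformed_legendre_factors_le {s t m μ : ℝ} (hs : s ∈ Ioo (0:ℝ) 1) (ht : t ∈ Ioo (0:ℝ) 1)
    (hm0 : 0 ≤ m) (hmμ : m ≤ μ) (hμ1 : μ < 1) :
    |(t ^ 2 - s ^ 2) + (1 - m * s ^ 2 - (1 - m) * t ^ 2) *
        (s ^ 2 / (2 * (1 - m * s ^ 2)) - t ^ 2 / (2 * (1 - (1 - m) * t ^ 2)))| ≤ 2 + (1 - μ)⁻¹ ∧
    |t ^ 2 / 2 * (1 - 2 * s ^ 2 + m * s ^ 2 * (1 - s ^ 2) / (1 - m * s ^ 2))| ≤ 2 + (1 - μ)⁻¹ ∧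
    |-(s ^ 2 / 2) * (1 - 2 * t ^ 2 + (1 - m) * t ^ 2 * (1 - t ^ 2) / (1 - (1 - m) * t ^ 2))|
      ≤ 2 + (1 - μ)⁻¹ := by
  have hm1 : m < 1 := hmμ.trans_lt hμ1
  obtain ⟨h1s, hms⟩ := soloInformed_legendre_radicand_pos hs hm1
  have h1t : 0 < 1 - t ^ 2 := (soloInformed_legendre_radicand_pos ht hm1).1
  have hmt := soloInformed_legendre_radicand_pos' ht hm0
  have hs2 : s ^ 2 < 1 := by linarith
  have ht2 : t ^ 2 < 1 := by linarith
  have hs0 : 0 ≤ s ^ 2 := sq_nonneg s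
  have ht0 : 0 ≤ t ^ 2 := sq_nonneg t
  have hμ : 0 < 1 - μ := by linarith
  have hIμ : 0 ≤ (1 - μ)⁻¹ := inv_nonneg.2 hμ.le
  -- (i) `0 ≤ N ≤ 1` and `0 ≤ N/(1 − m't²) ≤ 1`
  have hN0 : 0 ≤ 1 - m * s ^ 2 - (1 - m) * t ^ 2 := by nlinarith
  have hN1 : 1 - m * s ^ 2 - (1 - m) * t ^ 2 ≤ 1 := by nlinarith
  -- (ii) `s²/(2(1−ms²)) ≤ (1−μ)⁻¹/2`
  have hq1 : 0 ≤ s ^ 2 / (2 * (1 - m * s ^ 2)) := by positivity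
  have hD1 : 1 - μ ≤ 1 - m * s ^ 2 := by nlinarith
  have hq1' : s ^ 2 / (2 * (1 - m * s ^ 2)) ≤ (1 - μ)⁻¹ / 2 :=
    calc s ^ 2 / (2 * (1 - m * s ^ 2)) ≤ 1 / (2 * (1 - m * s ^ 2)) := by
          gcongr
      _ ≤ 1 / (2 * (1 - μ)) := by gcongr
      _ = (1 - μ)⁻¹ / 2 := by rw [one_div, mul_inv]; ring
  -- (iii) `0 ≤ N t²/(2(1 − m't²)) ≤ 1/2`
  have hq2 : 0 ≤ (1 - m * s ^ 2 - (1 - m) * t ^ 2) * (t ^ 2 / (2 * (1 - (1 - m) * t ^ 2))) := by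
    positivity
  have hq2' : (1 - m * s ^ 2 - (1 - m) * t ^ 2) * (t ^ 2 / (2 * (1 - (1 - m) * t ^ 2))) ≤ 1 / 2 := by
    rw [← mul_div_assoc, div_le_div_iff₀ (by positivity) (by norm_num)]
    nlinarith [mul_nonneg hm0 hs0, mul_nonneg hN0 ht0]
  -- (iv) `0 ≤ m s²(1−s²)/(1−ms²) ≤ (1−μ)⁻¹`
  have hq3 : 0 ≤ m * s ^ 2 * (1 - s ^ 2) / (1 - m * s ^ 2) := by positivity
  have hq3' : m * s ^ 2 * (1 - s ^ 2) / (1 - m * s ^ 2) ≤ (1 - μ)⁻¹ :=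
    calc m * s ^ 2 * (1 - s ^ 2) / (1 - m * s ^ 2) ≤ 1 / (1 - m * s ^ 2) := by
          gcongr; nlinarith [mul_nonneg hm0 hs0, mul_le_one₀ hm1.le hs0 hs2.le]
      _ ≤ 1 / (1 - μ) := by gcongr
      _ = (1 - μ)⁻¹ := one_div _
  -- (v) `0 ≤ m' t²(1−t²)/(1−m't²) ≤ 1`
  have hq4 : 0 ≤ (1 - m) * t ^ 2 * (1 - t ^ 2) / (1 - (1 - m) * t ^ 2) := by
    have : 0 ≤ 1 - m := by linarith
    positivity
  have hq4' : (1 - m) * t ^ 2 * (1 - t ^ 2) / (1 - (1 - m) * t ^ 2) ≤ 1 := by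
    rw [div_le_one hmt]
    have : 0 ≤ 1 - m := by linarith
    nlinarith [mul_nonneg this ht0]
  refine ⟨?_, ?_, ?_⟩
  · rw [abs_le]
    constructor
    · nlinarith [mul_nonneg hN0 hq1]
    · have : (1 - m * s ^ 2 - (1 - m) * t ^ 2) * (s ^ 2 / (2 * (1 - m * s ^ 2))) ≤ (1 - μ)⁻¹ / 2 :=
        (mul_le_of_le_one_left hq1 hN1).trans hq1'
      nlinarith
  · rw [abs_le]
    constructor <;> nlinarith [mul_nonneg ht0 hq3]
  · rw [abs_le]
    constructor <;> nlinarith [mul_nonneg hs0 hq4]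

/-- **The kernel is dominated by a sum of two Beta products.**  For `s, t ∈ (0,1)`,
`0 < m ≤ μ < 1`:
`k(s,t,m) ≤ (1−μ)^{-1/2} · [2 (1−s)^{-1/2} + 2 (1−s)^{-1/2} (1−t)^{-1/2} m^{-1/2}]`
— by `1 − s² ≥ 1 − s`, `1 − m s² ≥ 1 − μ`, and `(1−t²)(1−m't²) ≥ (1−t²)² ≥ 9/16` for `t ≤ ½`,
`≥ m t²(1−t²) ≥ ¼ m (1−t)` for `t ≥ ½`. [this work] -/
theorem soloInformed_legendre_kernel_le {s t m μ : ℝ} (hs : s ∈ Ioo (0:ℝ) 1) (ht : t ∈ Ioo (0:ℝ) 1)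
    (hm0 : 0 < m) (hmμ : m ≤ μ) (hμ1 : μ < 1) :
    (√(1 - s ^ 2))⁻¹ * (√(1 - m * s ^ 2))⁻¹ * ((√(1 - t ^ 2))⁻¹ * (√(1 - (1 - m) * t ^ 2))⁻¹) ≤
      (√(1 - μ))⁻¹ * (2 * (√(1 - s))⁻¹ + 2 * ((√(1 - s))⁻¹ * (√(1 - t))⁻¹ * (√m)⁻¹)) := by
  have hm1 : m < 1 := hmμ.trans_lt hμ1
  obtain ⟨h1s, hms⟩ := soloInformed_legendre_radicand_pos hs hm1
  have h1t : 0 < 1 - t ^ 2 := (soloInformed_legendre_radicand_pos ht hm1).1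
  have hmt := soloInformed_legendre_radicand_pos' ht hm0.le
  have hμ : 0 < 1 - μ := by linarith
  have h1s' : 0 < 1 - s := by linarith [hs.2]
  have h1t' : 0 < 1 - t := by linarith [ht.2]
  -- first two factors
  have hA : (√(1 - s ^ 2))⁻¹ ≤ (√(1 - s))⁻¹ := by
    rw [inv_le_inv₀ (Real.sqrt_pos.2 h1s) (Real.sqrt_pos.2 h1s')]
    exact Real.sqrt_le_sqrt (by nlinarith [hs.1, hs.2])
  have hB : (√(1 - m * s ^ 2))⁻¹ ≤ (√(1 - μ))⁻¹ := by
    rw [inv_le_inv₀ (Real.sqrt_pos.2 hms) (Real.sqrt_pos.2 hμ)]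
    exact Real.sqrt_le_sqrt (by nlinarith [sq_nonneg s, hs.1, hs.2])
  -- the last two factors
  have hCD : (√(1 - t ^ 2))⁻¹ * (√(1 - (1 - m) * t ^ 2))⁻¹ ≤ 2 + 2 * ((√(1 - t))⁻¹ * (√m)⁻¹) := by
    rw [← mul_inv, ← Real.sqrt_mul h1t.le]
    have hP : 0 < (1 - t ^ 2) * (1 - (1 - m) * t ^ 2) := mul_pos h1t hmt
    have h2 : 0 ≤ 2 * ((√(1 - t))⁻¹ * (√m)⁻¹) := by positivity
    rcases le_or_gt t (1 / 2) with htle | htgt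
    · -- `t ≤ 1/2`: the product is `≥ 9/16 ≥ 1/4`, so the inverse root is `≤ 2`
      have hge : (1 / 2) ^ 2 ≤ (1 - t ^ 2) * (1 - (1 - m) * t ^ 2) := by
        have ht2 : t ^ 2 ≤ 1 / 4 := by nlinarith [ht.1]
        have : 1 - t ^ 2 ≤ 1 - (1 - m) * t ^ 2 := by nlinarith [sq_nonneg t]
        nlinarith
      have : (√((1 - t ^ 2) * (1 - (1 - m) * t ^ 2)))⁻¹ ≤ 2 := by
        rw [inv_le_comm₀ (Real.sqrt_pos.2 hP) (by norm_num : (0:ℝ) < 2)]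
        rw [show (2 : ℝ)⁻¹ = √((1 / 2) ^ 2) by rw [Real.sqrt_sq (by norm_num)]; norm_num]
        exact Real.sqrt_le_sqrt hge
      linarith
    · -- `t > 1/2`: the product is `≥ m t²(1−t²) ≥ ¼ m (1 − t)`
      have hge : (1 / 2) ^ 2 * ((1 - t) * m) ≤ (1 - t ^ 2) * (1 - (1 - m) * t ^ 2) := by
        have h1 : 1 - t ≤ 1 - t ^ 2 := by nlinarith [ht.1, ht.2]
        have h2 : m * t ^ 2 ≤ 1 - (1 - m) * t ^ 2 := by nlinarith
        have ht4 : (1 / 2 : ℝ) ^ 2 ≤ t ^ 2 := pow_le_pow_left₀ (by norm_num) htgt.le 2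
        have h3 : (1 / 2) ^ 2 * m ≤ m * t ^ 2 := by
          rw [mul_comm]; exact mul_le_mul_of_nonneg_left ht4 hm0.le
        calc (1 / 2) ^ 2 * ((1 - t) * m) = (1 - t) * ((1 / 2) ^ 2 * m) := by ring
          _ ≤ (1 - t ^ 2) * (m * t ^ 2) := mul_le_mul h1 h3 (by positivity) h1t.le
          _ ≤ (1 - t ^ 2) * (1 - (1 - m) * t ^ 2) := mul_le_mul_of_nonneg_left h2 h1t.le
      have hQ : 0 < (1 / 2) ^ 2 * ((1 - t) * m) := by positivity
      have : (√((1 - t ^ 2) * (1 - (1 - m) * t ^ 2)))⁻¹ ≤ 2 * ((√(1 - t))⁻¹ * (√m)⁻¹) := by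
        have heq : 2 * ((√(1 - t))⁻¹ * (√m)⁻¹) = (√((1 / 2) ^ 2 * ((1 - t) * m)))⁻¹ := by
          rw [Real.sqrt_mul (by norm_num), Real.sqrt_sq (by norm_num), Real.sqrt_mul h1t'.le,
            mul_inv, mul_inv]
          norm_num
        rw [heq, inv_le_inv₀ (Real.sqrt_pos.2 hP) (Real.sqrt_pos.2 hQ)]
        exact Real.sqrt_le_sqrt hge
      linarith
  have hA0 : 0 ≤ (√(1 - s ^ 2))⁻¹ := by positivity
  have hB0 : 0 ≤ (√(1 - m * s ^ 2))⁻¹ := by positivity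
  have hCD0 : 0 ≤ (√(1 - t ^ 2))⁻¹ * (√(1 - (1 - m) * t ^ 2))⁻¹ := by positivity
  have hs0 : 0 ≤ (√(1 - s))⁻¹ := by positivity
  have hμ0 : 0 ≤ (√(1 - μ))⁻¹ := by positivity
  calc (√(1 - s ^ 2))⁻¹ * (√(1 - m * s ^ 2))⁻¹ * ((√(1 - t ^ 2))⁻¹ * (√(1 - (1 - m) * t ^ 2))⁻¹)
      ≤ (√(1 - s))⁻¹ * (√(1 - μ))⁻¹ * (2 + 2 * ((√(1 - t))⁻¹ * (√m)⁻¹)) :=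
        mul_le_mul (mul_le_mul hA hB hB0 hs0) hCD hCD0 (by positivity)
    _ = (√(1 - μ))⁻¹ * (2 * (√(1 - s))⁻¹ + 2 * ((√(1 - s))⁻¹ * (√(1 - t))⁻¹ * (√m)⁻¹)) := by
        ring

/-- The dominating function in Beta form: for `u ∈ (0,1)`, `(√(1−u))⁻¹ = u^{1−1}(1−u)^{½−1}`-style
rewriting — `(√x)⁻¹ = x ^ ((2⁻¹ : ℝ) − 1)` for `x > 0`. [folklore] -/
theorem soloInformed_inv_sqrt_eq_rpow {x : ℝ} (hx : 0 < x) :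
    (√x)⁻¹ = x ^ ((((1 / 2 : ℚ)) : ℝ) - 1) := by
  rw [Real.sqrt_eq_rpow, ← Real.rpow_neg hx.le]
  norm_num

end Summit.KontsevichZagierPeriods.KontsevichZagierPeriods.Theorems

end
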